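import Literature.IUT.HodgeTheaters.PuncturedEllipticGeomOriginProfiniteModel
import Literature.IUT.HodgeTheaters.PuncturedEllipticProLModelDatum
import HarnessLib

/-!
# [IUTchI] §1: the DIHEDRAL PROFINITE MODEL `D_l^∧` of the covering tower `X̲ → X → C`, `C̲ → C` — part 1:
# the orbifold group `W = F₂ ⋊ ℤ/2`, its dihedral quotient `W ↠ D_l`, the cusp words `γ_n = aⁿ[a,b]a⁻ⁿ`, and the
# `PuncturedEllipticData` over the profinite completion `Ŵ` (definitions + proofs)

Mochizuki, *Inter-universal Teichmüller theory I: construction of Hodge theaters*, kurims manuscript (May 2020),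
§1 p. 37 ("`X` a hyperbolic curve of type `(1,1)` … `C` a hyperbolic orbicurve of type `(1,1)_±` … `X̲ → X` the
covering determined by the quotient `Δ_X ↠ Δ_X^{ab} ⊗ ℤ/lℤ ↠ Q` … `C̲ := X̲/{±1}` … `ε⁰` the unique zero cusp of
`X̲`, `ε′, ε″` the two cusps over `ε̲`") [cite: Mochizuki2012, IUTchI §1 p.37] (D-0012 claim key; series status
DISPUTED — nothing of the series is asserted here); A. Grothendieck, SGA 1 Exp. XIII Cor. 2.12; S. Mochizuki,
*Topics in Absolute Anabelian Geometry I*, Lemma 4.5 (i) p. 54 (`IsFreeProOn`) [cite: MochizukiAbsTopI2012,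
Lemma 4.5 (i) p.54]; L. Ribes, P. Zalesskii, *Profinite Groups*, Prop. 3.2.2 / Lemma 3.2.6 (profinite completion)
[cite: RibesZalesskii2010, Prop 3.2.2].

WHY (cell abc-iut, seat abc-iut-L5-t1 gen 12, L5 ROWS #7 R48 residual «NV-JOINT»; L5-lead RULINGS #132 (2)(c)).
The [IUTchI] Cor. 1.2 closer of record «cor12_v17» (abc-iut-w6-d032 p509616, over this lineage's p508782 and
abc-iut-L5-d4's p508526) displays, per datum, the ORIGIN record `GeomOriginIota` (abc-iut-L5-t1 p501139) AND the
cusp action `CuspGalois` (p424023).  In the tree these are inhabited only SEPARATELY — `GeomOriginIota` at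
abc-iut-L4-t15's profinite `D₀` (p502197; `Π_C̲ := Π_C`, so no cusp action is possible there) and `CuspGalois` at
abc-iut-L5-d4's pro-`l` `M_l` (p495002; `Δ_X` not free profinite by design).  This file and its sequels build ONE
datum carrying BOTH: the profinite completion of the orbifold group of `C = X/{±1}` together with the genuine
dihedral covering tower.

THE MODEL (`l ≥ 5` prime, symbolic).  `W := F₂ ⋊ ℤ/2` (`F₂ = ⟨a, b⟩`, `σ a σ⁻¹ = a⁻¹`, `σ b σ⁻¹ = b⁻¹` —
abc-iut-L4-t15's `exists_inversionAction`); the DIHEDRAL QUOTIENT `ρ : W ↠ D_l = ℤ/l ⋊ ℤ/2`, `a ↦ r₁`, `b ↦ 1`,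
`σ ↦ s r₀` (`X̲ → C` is Galois with group `D_l`; `X̲ → X ↔` the rotations, `C̲ = X̲/⟨ι̲⟩ → C ↔ {1, s}`, NOT normal);
`Π_C := Ŵ`, `ρ̂ : Ŵ ↠ D_l` the continuous extension (`exists_lift_of_finite`), `Π_X := ρ̂⁻¹(rotations)` (index `2`),
`Π_C̲ := ρ̂⁻¹{1, s r₀}` (index `l`; abc-iut-L5-d4's `dihCbar`), so `Π_X̲ = Ker ρ̂` (index `2l`); `G_k := 1`
(`Δ = Π`); CUSPS of `X̲` := `ℤ/l`, the cusp with label `i` carrying the decomposition (= inertia) group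
`D_i := ⟨η(γ_n)⟩⁻`, `γ_n := aⁿ [a,b] a⁻ⁿ ∈ F₂`, `n := val(i + c₀)`, `c₀ := (l−1)/2` — the shift `c₀` is forced:
`σ γ_n σ⁻¹` is `Ker ρ`-conjugate to `γ_{−1−n}` (`[a⁻¹,b⁻¹] = (ab)⁻¹[a,b](ab)`), so `σ` acts on the labels by
`i ↦ −i` exactly when `2c₀ ≡ −1`; `ε⁰ := 0` (the unique `σ`-fixed cusp), `ε′ := 1`, `ε″ := −1`, `2ε := 2`
(this lineage's `ArrowModel` conventions, `cuspAct`: `r_k : i ↦ i + k`, `s r_k : i ↦ −k − i`).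
CONTENTS: §1 `W`, `γ_n`, the conjugation identities `a γ_n a⁻¹ = γ_{n+1}`, `σ γ_n σ⁻¹ = u γ_{−1−n} u⁻¹`; §2 `ρ` and
its values; §3 the labels `lab n = n − c₀` and **`exists_kerConj_γ`: for every `w ∈ W` and `n`, `w γ_n w⁻¹ =
u γ_{n′} u⁻¹` with `ρ u = 1` and `lab n′ = (ρ w) · lab n`**; §4 `ρ̂`, the subgroups, the datum `datum l h5`.
Sequels: `…ModelOrigin` (`GeomOriginIota` at the datum), `…ModelCusps` (`CuspGalois` at the datum), `…ModelNV`
(the joint non-vacuity statement for the Cor. 1.2 closer).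

HONEST LABEL: a group-theoretic model — the profinite completion of the TOPOLOGICAL orbifold fundamental group of
`C` over an algebraically closed base with its dihedral covering tower — not the étale `π₁` of a `k`-scheme (none is
constructed in the tree).  No instance, no notation, no `Prop`-valued definition; nothing here bears on [IUTchIII]
Cor. 3.12 or asserts that abc is proved or refuted; inhabited ≠ endorsed; no side taken.
-/

noncomputable section

open CategoryTheory Topology ProfiniteGrp DihedralGroup

namespace Literature.IUT.HodgeTheaters

namespace PuncturedEllipticData

namespace DihedralProfiniteModel

open Literature.AnabelianGeometry.AbsoluteAnabelian Literature.IUT.HodgeTheaters.ProfiniteCompletion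
  Literature.IUT.HodgeTheaters.GeomOriginProfiniteModel

/-! ### §1. The orbifold group `W = F₂ ⋊ ℤ/2` and the cusp words `γ_n = aⁿ [a,b] a⁻ⁿ` -/

/-- The inversion-on-letters action of `ℤ/2` on `F₂` (a choice of abc-iut-L4-t15's `exists_inversionAction`).
[cite: Mochizuki2012, IUTchI §1 p.37] -/
def invAct : Multiplicative (ZMod 2) →* MulAut (FreeGroup (Fin 2)) := Classical.choose exists_inversionAction

/-- `σ` inverts the free letters. [cite: Mochizuki2012, IUTchI §1 p.37] -/
theorem invAct_of (i : Fin 2) : invAct (Multiplicative.ofAdd 1) (FreeGroup.of i) = (FreeGroup.of i)⁻¹ :=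
  Classical.choose_spec exists_inversionAction i

/-- `σ` acts on `F₂` by the inversion-on-letters endomorphism. [cite: Mochizuki2012, IUTchI §1 p.37] -/
theorem invAct_eq_lift (x : FreeGroup (Fin 2)) :
    invAct (Multiplicative.ofAdd 1) x = FreeGroup.lift (fun i => (FreeGroup.of i)⁻¹) x := by
  change (invAct (Multiplicative.ofAdd 1)).toMonoidHom x = _
  congr 1
  ext i
  simp [invAct_of]

/-- The orbifold group `W = F₂ ⋊ ℤ/2` of the `(1,1)_±` orbicurve `C`. [cite: Mochizuki2012, IUTchI §1 p.37] -/
abbrev W : Type := FreeGroup (Fin 2) ⋊[invAct] Multiplicative (ZMod 2)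

/-- The letter `a ∈ F₂`. [cite: Mochizuki2012, IUTchI §1 p.37] -/
abbrev ga : FreeGroup (Fin 2) := FreeGroup.of 0

/-- The letter `b ∈ F₂`. [cite: Mochizuki2012, IUTchI §1 p.37] -/
abbrev gb : FreeGroup (Fin 2) := FreeGroup.of 1

/-- The generator `σ` of `ℤ/2`. [cite: Mochizuki2012, IUTchI §1 p.37] -/
abbrev gσ : Multiplicative (ZMod 2) := Multiplicative.ofAdd 1

/-- The cusp word `γ_n := aⁿ [a,b] a⁻ⁿ ∈ F₂` (`n ∈ ℤ`): the `a`-translates of the peripheral loop `[a,b]` of the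
once-punctured torus `X`; their `Ker(F₂ ↠ ℤ/l)`-conjugacy classes are the `l` cusps of `X̲`.
[cite: Mochizuki2012, IUTchI §1 p.37] -/
def γ (n : ℤ) : FreeGroup (Fin 2) := ga ^ n * (ga * gb * ga⁻¹ * gb⁻¹) * ga ^ (-n)

/-- `a γ_n a⁻¹ = γ_{n+1}`. [cite: Mochizuki2012, IUTchI §1 p.37] -/
theorem ga_mul_γ_mul_inv (n : ℤ) : ga * γ n * ga⁻¹ = γ (n + 1) := by
  simp only [γ, neg_add, zpow_add, zpow_neg, zpow_one]
  group

/-- `a⁻¹ γ_n a = γ_{n−1}`. [cite: Mochizuki2012, IUTchI §1 p.37] -/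
theorem ga_inv_mul_γ_mul (n : ℤ) : ga⁻¹ * γ n * ga = γ (n - 1) := by
  simp only [γ, zpow_neg, sub_eq_add_neg]
  group

/-- `aᵐ γ_n a⁻ᵐ = γ_{n+m}`. [cite: Mochizuki2012, IUTchI §1 p.37] -/
theorem ga_zpow_mul_γ (m n : ℤ) : ga ^ m * γ n * ga ^ (-m) = γ (n + m) := by
  simp only [γ, zpow_neg, neg_add]
  rw [show ga ^ n * (ga * gb * ga⁻¹ * gb⁻¹) * (ga ^ n)⁻¹ = ga ^ n * ((ga * gb * ga⁻¹ * gb⁻¹) * (ga ^ n)⁻¹) by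
    group, zpow_add]
  group

/-- `σ` sends `γ_n` to `(a⁻ⁿ b⁻¹ aⁿ) γ_{−1−n} (a⁻ⁿ b⁻¹ aⁿ)⁻¹` (`σ[a,b]σ⁻¹ = [a⁻¹,b⁻¹] = (ab)⁻¹[a,b](ab)`).
[cite: Mochizuki2012, IUTchI §1 p.37] -/
theorem invAct_γ (n : ℤ) : invAct gσ (γ n) =
    (ga ^ (-n) * gb⁻¹ * ga ^ n) * γ (-1 - n) * (ga ^ (-n) * gb⁻¹ * ga ^ n)⁻¹ := by
  rw [invAct_eq_lift]
  simp only [γ, map_mul, map_zpow, map_inv, FreeGroup.lift_apply_of, inv_inv, zpow_neg, neg_sub]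
  rw [show (-1 - n : ℤ) = -(n + 1) by ring, zpow_neg, zpow_add, zpow_one, inv_zpow]
  group

/-! ### §2. The dihedral quotient `ρ : W ↠ D_l` -/

variable (l : ℕ)

/-- `ρ` on `F₂`: `a ↦ r₁`, `b ↦ 1`. [cite: Mochizuki2012, IUTchI §1 p.37] -/
def ρF : FreeGroup (Fin 2) →* DihedralGroup l := FreeGroup.lift fun i => if i = 0 then r 1 else 1

/-- `ρ a = r₁`. [cite: Mochizuki2012, IUTchI §1 p.37] -/
@[simp] theorem ρF_ga : ρF l ga = r 1 := by simp [ρF]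

/-- `ρ b = 1`. [cite: Mochizuki2012, IUTchI §1 p.37] -/
@[simp] theorem ρF_gb : ρF l gb = 1 := by simp [ρF]

/-- `ρ` on `ℤ/2`: `σ ↦ s r₀`. [cite: Mochizuki2012, IUTchI §1 p.37] -/
def ρ2 : Multiplicative (ZMod 2) →* DihedralGroup l :=
  MonoidHom.mk' (fun g => if g = 1 then 1 else sr 0) (by
    have hcases : ∀ g : Multiplicative (ZMod 2), g = 1 ∨ g = gσ := by decide
    have hne : gσ ≠ 1 := by decide
    have h11 : gσ * gσ = 1 := by decide
    intro g h
    rcases hcases g with rfl | rfl <;> rcases hcases h with rfl | rfl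
    · simp
    · simp
    · simp
    · simp only [h11, hne, if_true, if_false, sr_mul_sr, sub_self, r_zero])

/-- `ρ σ = s r₀`. [cite: Mochizuki2012, IUTchI §1 p.37] -/
@[simp] theorem ρ2_gσ : ρ2 l gσ = sr 0 := by
  have hne : gσ ≠ 1 := by decide
  simp [ρ2, hne]

/-- Compatibility `ρ(σ x σ⁻¹) = s · ρ(x) · s` on `F₂`. [cite: Mochizuki2012, IUTchI §1 p.37] -/
theorem ρF_invAct (g : Multiplicative (ZMod 2)) :
    (ρF l).comp (invAct g).toMonoidHom = (MulAut.conj (ρ2 l g)).toMonoidHom.comp (ρF l) := by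
  have hcases : g = 1 ∨ g = gσ := by revert g; decide
  rcases hcases with rfl | rfl
  · ext i
    simp
  · ext i
    fin_cases i
    · simp [invAct_of, ρF]
    · simp [invAct_of, ρF]

/-- **The dihedral quotient `ρ : W = F₂ ⋊ ℤ/2 ↠ D_l`** (`a ↦ r₁`, `b ↦ 1`, `σ ↦ s r₀`): the Galois group of `X̲ → C`.
[cite: Mochizuki2012, IUTchI §1 p.37] -/
def ρW : W →* DihedralGroup l := SemidirectProduct.lift (ρF l) (ρ2 l) (ρF_invAct l)

/-- `ρ(inl x) = ρF x`. [cite: Mochizuki2012, IUTchI §1 p.37] -/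
@[simp] theorem ρW_inl (x : FreeGroup (Fin 2)) : ρW l (SemidirectProduct.inl x) = ρF l x := by
  simp [ρW]

/-- `ρ(inr g) = ρ2 g`. [cite: Mochizuki2012, IUTchI §1 p.37] -/
@[simp] theorem ρW_inr (g : Multiplicative (ZMod 2)) : ρW l (SemidirectProduct.inr g) = ρ2 l g := by
  simp [ρW]

/-- `ρ(aⁿ) = r_n`. [cite: Mochizuki2012, IUTchI §1 p.37] -/
theorem ρF_ga_zpow (n : ℤ) : ρF l (ga ^ n) = r (n : ZMod l) := by
  rw [map_zpow, ρF_ga, r_one_zpow]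

/-- `ρ(γ_n) = 1`: the cusp words lie in `Ker ρ` (the peripheral loops lift to `X̲`). [cite: Mochizuki2012, IUTchI §1 p.37] -/
@[simp] theorem ρF_γ (n : ℤ) : ρF l (γ n) = 1 := by
  simp only [γ, map_mul, map_inv, ρF_ga_zpow, ρF_ga, ρF_gb, inv_one, mul_one, inv_r, r_mul_r]
  rw [one_def]
  congr 1
  push_cast
  ring

/-- `ρ` is surjective (`r₁` and `s r₀` generate `D_l`). [cite: Mochizuki2012, IUTchI §1 p.37] -/
theorem ρW_surjective [NeZero l] : Function.Surjective (ρW l) := by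
  intro d
  cases d with
  | r k =>
    refine ⟨SemidirectProduct.inl (ga ^ (k.val : ℤ)), ?_⟩
    rw [ρW_inl, ρF_ga_zpow, Int.cast_natCast, ZMod.natCast_zmod_val]
  | sr k =>
    refine ⟨SemidirectProduct.inl (ga ^ (-(k.val : ℤ))) * SemidirectProduct.inr gσ, ?_⟩
    rw [map_mul, ρW_inl, ρW_inr, ρF_ga_zpow, ρ2_gσ, r_mul_sr, Int.cast_neg, Int.cast_natCast,
      ZMod.natCast_zmod_val, sub_neg_eq_add, zero_add]

/-! ### §3. Cusp labels and the `Ker ρ`-conjugation of the cusp words -/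

/-- The label shift `c₀ := (l−1)/2`. [cite: Mochizuki2012, IUTchI §1 p.37] -/
def c₀ : ℕ := (l - 1) / 2

/-- The cusp label of the word `γ_n`: `lab n := n − c₀ ∈ ℤ/l`. [cite: Mochizuki2012, IUTchI §1 p.37] -/
def lab (n : ℤ) : ZMod l := (n : ZMod l) - (c₀ l : ZMod l)

/-- `2 c₀ + 1 = 0` in `ℤ/l` for odd `l`. [cite: Mochizuki2012, IUTchI §1 p.37] -/
theorem two_mul_c₀_add_one (hl : Odd l) : (2 : ZMod l) * (c₀ l : ZMod l) + 1 = 0 := by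
  obtain ⟨m, rfl⟩ := hl
  have h : c₀ (2 * m + 1) = m := by unfold c₀; omega
  rw [h]
  have : ((2 * m + 1 : ℕ) : ZMod (2 * m + 1)) = 0 := ZMod.natCast_self _
  push_cast at this
  exact this

/-- `lab (n + 1) = r₁ · lab n`. [cite: Mochizuki2012, IUTchI §1 p.37] -/
theorem lab_add_one (n : ℤ) : lab l (n + 1) = ArrowModel.cuspAct l (r 1) (lab l n) := by
  rw [ArrowModel.cuspAct_r, lab, lab]
  push_cast
  ring

/-- `lab (n − 1) = r₋₁ · lab n`. [cite: Mochizuki2012, IUTchI §1 p.37] -/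
theorem lab_sub_one (n : ℤ) : lab l (n - 1) = ArrowModel.cuspAct l (r (-1)) (lab l n) := by
  rw [ArrowModel.cuspAct_r, lab, lab]
  push_cast
  ring

/-- `lab (−1 − n) = s r₀ · lab n` for odd `l` (the forced shift `2c₀ ≡ −1`). [cite: Mochizuki2012, IUTchI §1 p.37] -/
theorem lab_neg_one_sub (hl : Odd l) (n : ℤ) : lab l (-1 - n) = ArrowModel.cuspAct l (sr 0) (lab l n) := by
  rw [ArrowModel.cuspAct_sr, lab, lab, neg_zero, zero_sub]
  have h := two_mul_c₀_add_one l hl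
  push_cast
  linear_combination -h

/-- `lab m = lab n ↔ m ≡ n (mod l)`. [cite: Mochizuki2012, IUTchI §1 p.37] -/
theorem lab_eq_lab_iff (m n : ℤ) : lab l m = lab l n ↔ (m : ZMod l) = n := by
  rw [lab, lab, sub_left_inj]

/-- `Ker ρ`-conjugation data for `w = 1`. [cite: Mochizuki2012, IUTchI §1 p.37] -/
private theorem kerConj_one (n : ℤ) :
    ∃ n' : ℤ, ∃ u : W, ρW l u = 1 ∧ lab l n' = ArrowModel.cuspAct l (ρW l 1) (lab l n) ∧
      (1 : W) * SemidirectProduct.inl (γ n) * 1⁻¹ = u * SemidirectProduct.inl (γ n') * u⁻¹ :=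
  ⟨n, 1, map_one _, by rw [map_one, DihedralGroup.one_def, ArrowModel.cuspAct_r, add_zero], by group⟩

/-- `Ker ρ`-conjugation data are closed under products (`Ker ρ ⊴ W`). [cite: Mochizuki2012, IUTchI §1 p.37] -/
private theorem kerConj_mul {w w' : W}
    (hw : ∀ n : ℤ, ∃ n' : ℤ, ∃ u : W, ρW l u = 1 ∧ lab l n' = ArrowModel.cuspAct l (ρW l w) (lab l n) ∧
      w * SemidirectProduct.inl (γ n) * w⁻¹ = u * SemidirectProduct.inl (γ n') * u⁻¹)
    (hw' : ∀ n : ℤ, ∃ n' : ℤ, ∃ u : W, ρW l u = 1 ∧ lab l n' = ArrowModel.cuspAct l (ρW l w') (lab l n) ∧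
      w' * SemidirectProduct.inl (γ n) * w'⁻¹ = u * SemidirectProduct.inl (γ n') * u⁻¹) (n : ℤ) :
    ∃ n' : ℤ, ∃ u : W, ρW l u = 1 ∧ lab l n' = ArrowModel.cuspAct l (ρW l (w * w')) (lab l n) ∧
      (w * w') * SemidirectProduct.inl (γ n) * (w * w')⁻¹ = u * SemidirectProduct.inl (γ n') * u⁻¹ := by
  obtain ⟨n₁, u₁, hu₁, hl₁, he₁⟩ := hw' n
  obtain ⟨n₂, u₂, hu₂, hl₂, he₂⟩ := hw n₁
  refine ⟨n₂, w * u₁ * w⁻¹ * u₂, ?_, ?_, ?_⟩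
  · rw [map_mul, map_mul, map_mul, map_inv, hu₁, hu₂, mul_one, mul_one, mul_inv_cancel]
  · rw [hl₂, hl₁, map_mul]
    change _ = (ArrowModel.cuspHom l (ρW l w * ρW l w')) (lab l n)
    rw [map_mul, Equiv.Perm.mul_apply]
    rfl
  · rw [show w * w' * SemidirectProduct.inl (γ n) * (w * w')⁻¹ =
        w * (w' * SemidirectProduct.inl (γ n) * w'⁻¹) * w⁻¹ by group, he₁,
      show w * (u₁ * SemidirectProduct.inl (γ n₁) * u₁⁻¹) * w⁻¹ =
        (w * u₁ * w⁻¹) * (w * SemidirectProduct.inl (γ n₁) * w⁻¹) * (w * u₁ * w⁻¹)⁻¹ by group, he₂]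
    group

/-- `Ker ρ`-conjugation data for `w = a`: `a γ_n a⁻¹ = γ_{n+1}`. [cite: Mochizuki2012, IUTchI §1 p.37] -/
private theorem kerConj_inl_ga (n : ℤ) :
    ∃ n' : ℤ, ∃ u : W, ρW l u = 1 ∧
      lab l n' = ArrowModel.cuspAct l (ρW l (SemidirectProduct.inl ga)) (lab l n) ∧
      SemidirectProduct.inl ga * SemidirectProduct.inl (γ n) * (SemidirectProduct.inl ga)⁻¹ =
        u * SemidirectProduct.inl (γ n') * u⁻¹ :=
  ⟨n + 1, 1, map_one _, by rw [ρW_inl, ρF_ga, lab_add_one], by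
    rw [← map_inv, ← map_mul, ← map_mul, ga_mul_γ_mul_inv]; group⟩

/-- `Ker ρ`-conjugation data for `w = a⁻¹`: `a⁻¹ γ_n a = γ_{n−1}`. [cite: Mochizuki2012, IUTchI §1 p.37] -/
private theorem kerConj_inl_ga_inv (n : ℤ) :
    ∃ n' : ℤ, ∃ u : W, ρW l u = 1 ∧
      lab l n' = ArrowModel.cuspAct l (ρW l (SemidirectProduct.inl ga)⁻¹) (lab l n) ∧
      (SemidirectProduct.inl ga)⁻¹ * SemidirectProduct.inl (γ n) * (SemidirectProduct.inl ga)⁻¹⁻¹ =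
        u * SemidirectProduct.inl (γ n') * u⁻¹ :=
  ⟨n - 1, 1, map_one _, by rw [map_inv, ρW_inl, ρF_ga, inv_r, lab_sub_one], by
    rw [inv_inv, ← map_inv, ← map_mul, ← map_mul, ga_inv_mul_γ_mul]; group⟩

/-- `Ker ρ`-conjugation data for `w = b` (`b ∈ Ker ρ`). [cite: Mochizuki2012, IUTchI §1 p.37] -/
private theorem kerConj_inl_gb (n : ℤ) :
    ∃ n' : ℤ, ∃ u : W, ρW l u = 1 ∧
      lab l n' = ArrowModel.cuspAct l (ρW l (SemidirectProduct.inl gb)) (lab l n) ∧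
      SemidirectProduct.inl gb * SemidirectProduct.inl (γ n) * (SemidirectProduct.inl gb)⁻¹ =
        u * SemidirectProduct.inl (γ n') * u⁻¹ :=
  ⟨n, SemidirectProduct.inl gb, by rw [ρW_inl, ρF_gb],
    by rw [ρW_inl, ρF_gb, DihedralGroup.one_def, ArrowModel.cuspAct_r, add_zero], rfl⟩

/-- `Ker ρ`-conjugation data for `w = b⁻¹`. [cite: Mochizuki2012, IUTchI §1 p.37] -/
private theorem kerConj_inl_gb_inv (n : ℤ) :
    ∃ n' : ℤ, ∃ u : W, ρW l u = 1 ∧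
      lab l n' = ArrowModel.cuspAct l (ρW l (SemidirectProduct.inl gb)⁻¹) (lab l n) ∧
      (SemidirectProduct.inl gb)⁻¹ * SemidirectProduct.inl (γ n) * (SemidirectProduct.inl gb)⁻¹⁻¹ =
        u * SemidirectProduct.inl (γ n') * u⁻¹ :=
  ⟨n, (SemidirectProduct.inl gb)⁻¹, by rw [map_inv, ρW_inl, ρF_gb, inv_one],
    by rw [map_inv, ρW_inl, ρF_gb, inv_one, DihedralGroup.one_def, ArrowModel.cuspAct_r, add_zero],
    by rw [inv_inv]⟩

/-- `Ker ρ`-conjugation data for `w = σ`: `σ γ_n σ⁻¹ = u γ_{−1−n} u⁻¹`, `u = a⁻ⁿ b⁻¹ aⁿ ∈ Ker ρ`.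
[cite: Mochizuki2012, IUTchI §1 p.37] -/
private theorem kerConj_inr_gσ (hl : Odd l) (n : ℤ) :
    ∃ n' : ℤ, ∃ u : W, ρW l u = 1 ∧
      lab l n' = ArrowModel.cuspAct l (ρW l (SemidirectProduct.inr gσ)) (lab l n) ∧
      SemidirectProduct.inr gσ * SemidirectProduct.inl (γ n) * (SemidirectProduct.inr gσ)⁻¹ =
        u * SemidirectProduct.inl (γ n') * u⁻¹ := by
  refine ⟨-1 - n, SemidirectProduct.inl (ga ^ (-n) * gb⁻¹ * ga ^ n), ?_, ?_, ?_⟩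
  · rw [ρW_inl, map_mul, map_mul, map_inv, ρF_ga_zpow, ρF_ga_zpow, ρF_gb, inv_one, mul_one, r_mul_r, one_def]
    congr 1
    push_cast
    ring
  · rw [ρW_inr, ρ2_gσ, lab_neg_one_sub l hl]
  · rw [← map_inv SemidirectProduct.inr gσ, ← SemidirectProduct.inl_aut, invAct_γ]
    simp only [map_mul, map_inv]

/-- **`Ker ρ`-conjugation of the cusp words.** For every `w ∈ W` and `n ∈ ℤ` there are `n′ ∈ ℤ` and `u ∈ Ker ρ`
with `w γ_n w⁻¹ = u γ_{n′} u⁻¹` and `lab n′ = ρ(w) · lab n` (the dihedral action on the labels, abc-iut-L5-t1's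
`ArrowModel.cuspAct`): checked on the generators `a^{±1}`, `b^{±1}`, `σ` and closed under products (`Ker ρ ⊴ W`).
[cite: Mochizuki2012, IUTchI §1 p.37] -/
theorem exists_kerConj_γ (hl : Odd l) (w : W) (n : ℤ) :
    ∃ n' : ℤ, ∃ u : W, ρW l u = 1 ∧ lab l n' = ArrowModel.cuspAct l (ρW l w) (lab l n) ∧
      w * SemidirectProduct.inl (γ n) * w⁻¹ = u * SemidirectProduct.inl (γ n') * u⁻¹ := by
  suffices h : ∀ w : W, ∀ n : ℤ, ∃ n' : ℤ, ∃ u : W, ρW l u = 1 ∧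
      lab l n' = ArrowModel.cuspAct l (ρW l w) (lab l n) ∧
      w * SemidirectProduct.inl (γ n) * w⁻¹ = u * SemidirectProduct.inl (γ n') * u⁻¹ from h w n
  intro w
  rw [← SemidirectProduct.inl_left_mul_inr_right w]
  refine kerConj_mul l ?_ ?_
  · refine FreeGroup.induction_on w.left (by rw [map_one]; exact kerConj_one l) (fun i => ?_) (fun i _ => ?_)
      (fun x y hx hy => by rw [map_mul]; exact kerConj_mul l hx hy)
    · fin_cases i
      · exact kerConj_inl_ga l
      · exact kerConj_inl_gb l
    · rw [map_inv]
      fin_cases i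
      · exact kerConj_inl_ga_inv l
      · exact kerConj_inl_gb_inv l
  · have hcases : w.right = 1 ∨ w.right = gσ := by generalize w.right = g; revert g; decide
    rcases hcases with h | h
    · rw [h, map_one]; exact kerConj_one l
    · rw [h]; exact kerConj_inr_gσ l hl

/-- **Words with congruent indices are `Ker ρ`-conjugate**: `γ_m = u γ_n u⁻¹` with `u = a^{m−n} ∈ Ker ρ` when
`m ≡ n (mod l)`. [cite: Mochizuki2012, IUTchI §1 p.37] -/
theorem exists_kerConj_γ_of_modEq {m n : ℤ} (h : (m : ZMod l) = n) :
    ∃ u : W, ρW l u = 1 ∧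
      SemidirectProduct.inl (γ m) = u * SemidirectProduct.inl (γ n) * u⁻¹ := by
  refine ⟨SemidirectProduct.inl (ga ^ (m - n)), ?_, ?_⟩
  · rw [ρW_inl, ρF_ga_zpow, Int.cast_sub, h, sub_self, ← DihedralGroup.one_def]
  · rw [← map_inv, ← map_mul, ← map_mul, ← zpow_neg, ga_zpow_mul_γ]
    congr 2
    ring

end DihedralProfiniteModel

end PuncturedEllipticData

end Literature.IUT.HodgeTheaters

end
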